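import Literature.MathematicalPhysics.QuantumLattice.YangMillsStressEnergy
import HarnessLib

/-!
# The Bochner–Weitzenböck identity for the curvature under the Yang–Mills heat flow
# (Waldron 2019, §3: the differential inequality `(∂ₜ − Δ)|F|² ≤ −2|∇F|² + C|F|³`)

A step of the printed proof of Waldron's Theorem 1.1 (A. Waldron, *Long-time existence for
Yang–Mills flow*, Invent. math. 217 (2019)), on which the named fact
`Literature.MathematicalPhysics.QuantumLattice.Waldron2019_yangMillsFlow_flatTorus` rests
(`Waldron2019_yangMillsFlow_flatTorus_of_thm11`): the parabolic inequality for the energy density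
invoked in the proof of Prop. 3.4 ("recall the differential inequality `(∂ₜ − Δ)v ≤ Av² + Bv`",
`v = |F|`, `B ∝ ‖Rm‖ = 0` in the flat case) and underlying the `ε`-regularity of Prop. 3.1
([instantons] (2.1): `(∂ₜ + Δ)u ≤ −2|∇F⁺|² + Au^{3/2} + Bu`). Flat setting of the named fact
(`E` a finite-dimensional real inner product space, frame `b`, coefficients `M_m(ℂ)` with the
Hilbert–Schmidt inner product for the density statements, general normed algebras `𝔸` for the
algebraic identities); `F(u,v) = curvature A x u v`, `D_u = covDeriv A · x u`,
`e = ∑_{i<j}‖F_{ij}‖² = ½∑_{ij}‖F_{ij}‖²`.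

* `fderiv_lie_connection_apply` — `∂_u [A_v, φ] = [∂_uA_v, φ] + [A_v, ∂_uφ]`;
* `covDeriv_covDeriv_sub_eq_lie` — **curvature as commutator of covariant derivatives** on
  sections of the adjoint bundle: `D_u(D_vφ) − D_v(D_uφ) = [F(u,v), φ]` (flat base, constant
  frame);
* `covDeriv_sum_covDeriv_curvature_sub_eq` — the **Weitzenböck identity for the Yang–Mills
  vector field**: with `(div F)_v = ∑ᵢ Dᵢ F(bᵢ, v)`,
  `D_u (div F)_v − D_v (div F)_u = ∑ᵢ DᵢDᵢ F(u,v) + 2∑ᵢ [F(u,bᵢ), F(bᵢ,v)]`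
  (Bianchi identity twice and the commutator formula);
* `hasDerivAt_curvature_of_flow_eq_laplacian` — under `∂ₜA = div_A F` (= `−D^*F`), the curvature
  evolves by the **gauge-covariant heat equation** `∂ₜ F(u,v) = ∑ᵢ DᵢDᵢ F(u,v) + 2∑ᵢ [F(u,bᵢ), F(bᵢ,v)]`
  (`∂ₜF = −Δ_A F`, Donaldson–Kronheimer (6.2.11), flat Weitzenböck formula);
* `sum_fderiv_fderiv_ymDensityOfBasis_eq` — `Δe = ∑_{ijk}‖DᵢF_{jk}‖² + ∑_{jk}⟨F_{jk}, ∑ᵢDᵢDᵢF_{jk}⟩`;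
* `deriv_ymDensityOfBasis_sub_laplacian_eq` — **the Bochner identity along the flow**
  `∂ₜe − Δe = −∑_{ijk}‖DᵢF_{jk}‖² + 2∑_{ijk}⟨F_{jk}, [F_{ji}, F_{ik}]⟩`;
* `deriv_ymDensityOfBasis_sub_laplacian_le` — **the differential inequality**
  `∂ₜe − Δe ≤ −∑_{ijk}‖DᵢF_{jk}‖² + 8√2 (card ι)³ e^{3/2}`.

References: A. Waldron, *Long-time existence for Yang–Mills flow*, Invent. math. 217 (2019),
1069–1147, proof of Prop. 3.4 [Waldron2019]; A. Waldron, *Instantons and singularities in the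
Yang–Mills flow*, Calc. Var. PDE 55 (2016), §2 (2.1) [Waldron2016]; S. K. Donaldson,
P. B. Kronheimer, *The Geometry of Four-Manifolds* (1990), (2.1.21), §6.2.3 [DonaldsonKronheimer1990].
-/

noncomputable section

open scoped ContDiff Topology RealInnerProductSpace Matrix
open Set Filter

namespace Literature.MathematicalPhysics.QuantumLattice

/-! ### Curvature as the commutator of covariant derivatives -/

section Commutator

variable {E : Type*} [NormedAddCommGroup E] [InnerProductSpace ℝ E]
variable {𝔸 : Type*} [NormedRing 𝔸] [NormedAlgebra ℝ 𝔸]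

/-- Product rule for the bracket with a connection component:
`∂_u [A_v, φ](x) = [(DA(x)u) v, φ(x)] + [A_v(x), ∂_uφ(x)]`. [folklore] -/
theorem fderiv_lie_connection_apply (A : Connection E 𝔸) {φ : E → 𝔸} {x : E}
    (hA : DifferentiableAt ℝ A x) (hφ : DifferentiableAt ℝ φ x) (u v : E) :
    fderiv ℝ (fun y => ⁅A y v, φ y⁆) x u = ⁅fderiv ℝ A x u v, φ x⁆ + ⁅A x v, fderiv ℝ φ x u⁆ := by
  have hAv : HasFDerivAt (fun y => A y v) ((fderiv ℝ A x).flip v) x :=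
    hasFDerivAt_clm_apply_const hA.hasFDerivAt v
  have hφ' : HasFDerivAt φ (fderiv ℝ φ x) x := hφ.hasFDerivAt
  have heq : (fun y => ⁅A y v, φ y⁆) = fun y => A y v * φ y - φ y * A y v :=
    funext fun y => Ring.lie_def _ _
  rw [heq, ((hAv.fun_mul' hφ').fun_sub (hφ'.fun_mul' hAv)).fderiv]
  simp only [sub_apply, add_apply, smul_apply, smul_eq_mul, op_smul_eq_mul,
    ContinuousLinearMap.flip_apply, Ring.lie_def]
  noncomm_ring

/-- The covariant derivative of a `C^{k+1}` section along a `C^k` connection, as a function of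
the base point, is `C^k` (alias of `contDiff_covDeriv_apply`). [folklore] -/
theorem differentiableAt_covDeriv_apply {A : Connection E 𝔸} {φ : E → 𝔸}
    (hA : ContDiff ℝ 1 A) (hφ : ContDiff ℝ 2 φ) (v x : E) :
    DifferentiableAt ℝ (fun y => covDeriv A φ y v) x := by
  have h2 : (2 : WithTop ℕ∞) = 1 + 1 := by norm_num
  rw [h2] at hφ
  exact ((contDiff_covDeriv_apply hA hφ v).differentiable one_ne_zero) x

/-- **Curvature is the commutator of covariant derivatives.** For a `C¹` connection `A` on
flat space, a `C²` section `φ` of the adjoint bundle and constant vectors `u, v`: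
`D_u(D_v φ)(x) − D_v(D_u φ)(x) = [F_A(x)(u,v), φ(x)]`. Donaldson–Kronheimer §2.1.2.
[cite: DonaldsonKronheimer1990, §2.1.2] -/
theorem covDeriv_covDeriv_sub_eq_lie (A : Connection E 𝔸) {φ : E → 𝔸} (hA : ContDiff ℝ 1 A)
    (hφ : ContDiff ℝ 2 φ) (x u v : E) :
    covDeriv A (fun y => covDeriv A φ y v) x u - covDeriv A (fun y => covDeriv A φ y u) x v =
      ⁅curvature A x u v, φ x⁆ := by
  -- derivatives of `φ`
  set φ' : E → E →L[ℝ] 𝔸 := fderiv ℝ φ with hφ'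
  set φ'' : E →L[ℝ] E →L[ℝ] 𝔸 := fderiv ℝ (fderiv ℝ φ) x with hφ''
  have hdφ : ∀ y, HasFDerivAt φ (φ' y) y := fun y => (hφ.differentiable two_ne_zero y).hasFDerivAt
  have hdφ' : HasFDerivAt φ' φ'' x :=
    ((hφ.fderiv_right (m := 1) le_rfl).differentiable one_ne_zero x).hasFDerivAt
  have hsymm : ∀ a c, φ'' a c = φ'' c a := fun a c => second_derivative_symmetric hdφ hdφ' a c
  have hAd : DifferentiableAt ℝ A x := (hA.differentiable one_ne_zero) x
  have hAw : ∀ w, DifferentiableAt ℝ (fun y => A y w) x := fun w =>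
    hAd.clm_apply (differentiableAt_const w)
  -- the components `y ↦ φ'(y) w` and their derivatives
  have hc : ∀ w, HasFDerivAt (fun y => φ' y w) (φ''.flip w) x := fun w =>
    hasFDerivAt_clm_apply_const hdφ' w
  -- derivative of `y ↦ D_w φ(y) = φ'(y) w + [A_w(y), φ(y)]`
  have hD : ∀ w z, fderiv ℝ (fun y => covDeriv A φ y w) x z =
      φ'' z w + (⁅fderiv ℝ A x z w, φ x⁆ + ⁅A x w, φ' x z⁆) := by
    intro w z
    have hlie : DifferentiableAt ℝ (fun y => ⁅A y w, φ y⁆) x := by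
      have heq : (fun y => ⁅A y w, φ y⁆) = fun y => A y w * φ y - φ y * A y w :=
        funext fun y => Ring.lie_def _ _
      rw [heq]
      have hAw' : HasFDerivAt (fun y => A y w) ((fderiv ℝ A x).flip w) x :=
        hasFDerivAt_clm_apply_const hAd.hasFDerivAt w
      exact ((hAw'.fun_mul' (hdφ x)).fun_sub ((hdφ x).fun_mul' hAw')).differentiableAt
    unfold covDeriv
    rw [fderiv_fun_add (hc w).differentiableAt hlie, add_apply, (hc w).fderiv,
      ContinuousLinearMap.flip_apply, fderiv_lie_connection_apply A hAd (hdφ x).differentiableAt z w]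
  have hout : ∀ w z, covDeriv A (fun y => covDeriv A φ y w) x z =
      fderiv ℝ (fun y => covDeriv A φ y w) x z + ⁅A x z, covDeriv A φ x w⁆ := fun w z => rfl
  rw [hout v u, hout u v, hD v u, hD u v]
  simp only [covDeriv]
  rw [hsymm u v, curvature_eq_of_differentiableAt A hAd u v,
    show fderiv ℝ φ x = φ' x from rfl]
  simp only [Ring.lie_def]
  noncomm_ring

/-! ### The Weitzenböck identity for the Yang–Mills vector field -/

variable {ι : Type*} [Fintype ι]

/-- **Weitzenböck identity for `div_A F_A`.** For a `C³` connection on flat space, an orthonormal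
frame `b` and vectors `u, v`, writing `(div F)_w(y) = ∑ᵢ D_{bᵢ} F(bᵢ, w)(y)` (`= −(D^*F)_w`):
`D_u (div F)_v − D_v (div F)_u = ∑ᵢ D_{bᵢ}D_{bᵢ} F(u,v) + 2 ∑ᵢ [F(u,bᵢ), F(bᵢ,v)]`, i.e.
`−D D^*F = −∇^*∇F + F # F` on `DF = 0` (the Bianchi identity `D_uF(bᵢ,v) = D_{bᵢ}F(u,v) + D_vF(bᵢ,u)`
inside, and the commutator formula `[D_u, D_{bᵢ}] = [F(u,bᵢ), ·]`). Donaldson–Kronheimer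
(2.1.21), §6.2.3. [cite: DonaldsonKronheimer1990, §6.2.3] -/
theorem covDeriv_sum_covDeriv_curvature_sub_eq (b : OrthonormalBasis ι ℝ E) (A : Connection E 𝔸)
    (hA : ContDiff ℝ 3 A) (x u v : E) :
    covDeriv A (fun y => ∑ i, covDeriv A (fun z => curvature A z (b i) v) y (b i)) x u -
        covDeriv A (fun y => ∑ i, covDeriv A (fun z => curvature A z (b i) u) y (b i)) x v =
      ∑ i, covDeriv A (fun y => covDeriv A (fun z => curvature A z u v) y (b i)) x (b i) +
        (2 : ℝ) • ∑ i, ⁅curvature A x u (b i), curvature A x (b i) v⁆ := by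
  -- regularity
  have hA1 : ContDiff ℝ 1 A := hA.of_le (by norm_num)
  have hA2 : ContDiff ℝ 2 A := hA.of_le (by norm_num)
  have hA21 : ContDiff ℝ (2 + 1) A := by rw [show (2 : WithTop ℕ∞) + 1 = 3 by norm_num]; exact hA
  have hA12 : ContDiff ℝ (1 + 2) A := by rw [show (1 : WithTop ℕ∞) + 2 = 3 by norm_num]; exact hA
  have hG2 : ∀ a c, ContDiff ℝ 2 (fun y => curvature A y a c) := fun a c =>
    contDiff_curvature_apply hA21 a c
  have hDG : ∀ a c w, Differentiable ℝ fun y => covDeriv A (fun z => curvature A z a c) y w :=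
    fun a c w => (contDiff_covDeriv_curvature_apply (k := 1) hA12 a c w).differentiable one_ne_zero
  -- Step 1: linearity of the outer covariant derivative
  have hlin : ∀ a w, covDeriv A (fun y => ∑ i, covDeriv A (fun z => curvature A z (b i) a) y (b i))
      x w = ∑ i, covDeriv A (fun y => covDeriv A (fun z => curvature A z (b i) a) y (b i)) x w :=
    fun a w => covDeriv_fun_sum Finset.univ A (fun i _ => hDG (b i) a (b i) x) w
  -- Step 2: the commutator formula, `D_w D_{bᵢ} = D_{bᵢ} D_w + [F(w, bᵢ), ·]`
  have hcomm : ∀ a w i, covDeriv A (fun y => covDeriv A (fun z => curvature A z (b i) a) y (b i))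
      x w = covDeriv A (fun y => covDeriv A (fun z => curvature A z (b i) a) y w) x (b i) +
        ⁅curvature A x w (b i), curvature A x (b i) a⁆ := fun a w i => by
    have h := covDeriv_covDeriv_sub_eq_lie A hA1 (hG2 (b i) a) x w (b i)
    rw [sub_eq_iff_eq_add] at h
    rw [h, add_comm]
  -- Step 3: the Bianchi identity inside the inner covariant derivative
  have hbianchi : ∀ a c i, (fun y => covDeriv A (fun z => curvature A z (b i) c) y a) =
      fun y => covDeriv A (fun z => curvature A z a c) y (b i) +
        covDeriv A (fun z => curvature A z (b i) a) y c := fun a c i =>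
    funext fun y => covDeriv_curvature_bianchi A hA2 y a (b i) c
  have hinner : ∀ a c i, covDeriv A (fun y => covDeriv A (fun z => curvature A z (b i) c) y a)
      x (b i) = covDeriv A (fun y => covDeriv A (fun z => curvature A z a c) y (b i)) x (b i) +
        covDeriv A (fun y => covDeriv A (fun z => curvature A z (b i) a) y c) x (b i) := by
    intro a c i
    rw [hbianchi a c i]
    exact covDeriv_fun_add A (hDG a c (b i) x) (hDG (b i) a c x) (b i)
  -- Step 4: per index, the `D_{bᵢ} D_v F(bᵢ, u)` terms cancel
  have hper : ∀ i, covDeriv A (fun y => covDeriv A (fun z => curvature A z (b i) v) y (b i)) x u -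
      covDeriv A (fun y => covDeriv A (fun z => curvature A z (b i) u) y (b i)) x v =
      covDeriv A (fun y => covDeriv A (fun z => curvature A z u v) y (b i)) x (b i) +
        (2 : ℝ) • ⁅curvature A x u (b i), curvature A x (b i) v⁆ := by
    intro i
    rw [hcomm v u i, hcomm u v i, hinner u v i]
    have hskew : ⁅curvature A x v (b i), curvature A x (b i) u⁆ =
        -⁅curvature A x u (b i), curvature A x (b i) v⁆ := by
      rw [curvature_antisymm A x v (b i), curvature_antisymm A x (b i) u, Ring.lie_def,
        Ring.lie_def]
      noncomm_ring
    rw [hskew, two_smul]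
    abel
  -- assemble
  rw [hlin v u, hlin u v, ← Finset.sum_sub_distrib, Finset.smul_sum, ← Finset.sum_add_distrib]
  exact Finset.sum_congr rfl fun i _ => hper i

end Commutator

/-! ### The gauge-covariant heat equation for the curvature along the flow -/

section FlowEvolution

variable {E : Type*} [NormedAddCommGroup E] [InnerProductSpace ℝ E] [FiniteDimensional ℝ E]
variable {𝔸 : Type*} [NormedRing 𝔸] [NormedAlgebra ℝ 𝔸]
variable {ι : Type*} [Fintype ι]

/-- **Evolution of the curvature under the Yang–Mills heat flow.** Let `A` be jointly smooth on
`𝒯 × E` (`𝒯` open) and solve `∂ₜA = div_A F_A` (= `−D^*F`) at the time `t ∈ 𝒯`. Then at every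
point, in an orthonormal frame `b`,
`∂ₜ F(u,v) = ∑ᵢ D_{bᵢ}D_{bᵢ} F(u,v) + 2∑ᵢ [F(u,bᵢ), F(bᵢ,v)]` — the gauge-covariant nonlinear
heat equation `∂ₜF = −Δ_A F = −∇^*∇F + F # F` (Waldron: `(∂ₜ + DD^*)F = 0`, `DF = 0`; flat
Weitzenböck formula). [cite: Waldron2019, §2 (display before (2.4)) and §4.2] -/
theorem hasDerivAt_curvature_of_flow (b : OrthonormalBasis ι ℝ E)
    {A : ℝ → Connection E 𝔸} {𝒯 : Set ℝ} (h𝒯 : IsOpen 𝒯)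
    (hA : ContDiffOn ℝ ∞ (fun p : ℝ × E => A p.1 p.2) (𝒯 ×ˢ (univ : Set E)))
    (hpde : ∀ ⦃s : ℝ⦄, s ∈ 𝒯 → ∀ y w, deriv (fun s' => A s' y w) s = divCurvature (A s) y w)
    {t : ℝ} (ht : t ∈ 𝒯) (x u v : E) :
    HasDerivAt (fun s => curvature (A s) x u v)
      (∑ i, covDeriv (A t) (fun y => covDeriv (A t) (fun z => curvature (A t) z u v) y (b i)) x
          (b i) + (2 : ℝ) • ∑ i, ⁅curvature (A t) x u (b i), curvature (A t) x (b i) v⁆) t := by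
  have hU : IsOpen (𝒯 ×ˢ (univ : Set E)) := h𝒯.prod isOpen_univ
  have hp : (t, x) ∈ 𝒯 ×ˢ (univ : Set E) := ⟨ht, mem_univ x⟩
  have hsm : ContDiff ℝ ∞ (A t) := contDiff_slice_of_contDiffOn_prod hA ht
  have hA3 : ContDiff ℝ 3 (A t) := hsm.of_le ENat.LEInfty.out
  have hA2 : ContDiff ℝ 2 (A t) := hsm.of_le ENat.LEInfty.out
  have h := hasDerivAt_curvature_slice hU hA ENat.LEInfty.out hp u v
  -- `Ȧ = div_A F`, in the frame `b`
  have hdiv : ∀ y w, divCurvature (A t) y w =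
      fderiv ℝ (fun p : ℝ × E => A p.1 p.2) (t, y) ((1 : ℝ), (0 : E)) w := fun y w => by
    rw [← hpde ht y w]
    exact (hasDerivAt_slice_apply hU hA (by simp) (⟨ht, mem_univ y⟩ : (t, y) ∈ 𝒯 ×ˢ univ) w).deriv
  have hAdot : ∀ w, (fun y => fderiv ℝ (fun p : ℝ × E => A p.1 p.2) (t, y) ((1 : ℝ), (0 : E)) w) =
      fun y => ∑ i, covDeriv (A t) (fun z => curvature (A t) z (b i) w) y (b i) := by
    intro w
    funext y
    rw [← hdiv y w, divCurvature_eq_sum_orthonormalBasis b (A t) hA2 y w]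
  refine h.congr_deriv ?_
  rw [hAdot v, hAdot u]
  exact covDeriv_sum_covDeriv_curvature_sub_eq b (A t) hA3 x u v

end FlowEvolution

/-! ### The Bochner identity for the energy density -/

section Bochner

open scoped Matrix.Norms.Frobenius

attribute [local instance] frobeniusInnerProductSpace

variable {m : Type*} [Fintype m] [DecidableEq m]
variable {E : Type*} [NormedAddCommGroup E] [InnerProductSpace ℝ E] [FiniteDimensional ℝ E]
variable {ι : Type*} [Fintype ι] [LinearOrder ι]

omit [FiniteDimensional ℝ E] in
/-- **The Laplacian of the energy density.** For a `C³` `𝔲(m)`-valued connection and an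
orthonormal frame `b`: `∑ᵢ ∂ᵢ∂ᵢ e = ∑_{ijk} ‖DᵢF_{jk}‖² + ∑_{ijk} ⟨F_{jk}, DᵢDᵢF_{jk}⟩`
(`e = ½∑_{jk}‖F_{jk}‖²`, covariant Leibniz rule twice). [folklore] -/
theorem sum_fderiv_fderiv_ymDensityOfBasis_eq (b : OrthonormalBasis ι ℝ E)
    {A : Connection E (Matrix m m ℂ)} (hA : ContDiff ℝ 3 A)
    (hval : A.IsValuedIn (skewAdjoint.submodule ℝ (Matrix m m ℂ))) (x : E) :
    ∑ i, fderiv ℝ (fun y => fderiv ℝ (fun z => ymDensityOfBasis b A z) y (b i)) x (b i) =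
      ∑ i, ∑ j, ∑ k, ‖covDeriv A (fun z => curvature A z (b j) (b k)) x (b i)‖ ^ 2 +
        ∑ i, ∑ j, ∑ k, ⟪curvature A x (b j) (b k),
          covDeriv A (fun y => covDeriv A (fun z => curvature A z (b j) (b k)) y (b i)) x (b i)⟫ := by
  have hA2 : ContDiff ℝ 2 A := hA.of_le (by norm_num)
  have hA21 : ContDiff ℝ (2 + 1) A := by rw [show (2 : WithTop ℕ∞) + 1 = 3 by norm_num]; exact hA
  have hA12 : ContDiff ℝ (1 + 2) A := by rw [show (1 : WithTop ℕ∞) + 2 = 3 by norm_num]; exact hA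
  have hFd : ∀ j k, Differentiable ℝ fun z => curvature A z (b j) (b k) := fun j k =>
    (contDiff_curvature_apply hA21 (b j) (b k)).differentiable two_ne_zero
  have hDd : ∀ i j k, Differentiable ℝ fun y => covDeriv A (fun z => curvature A z (b j) (b k)) y
      (b i) := fun i j k =>
    (contDiff_covDeriv_curvature_apply (k := 1) hA12 (b j) (b k) (b i)).differentiable one_ne_zero
  -- first derivatives: `∂ᵢ e = ∑_{jk} ⟨F_{jk}, DᵢF_{jk}⟩`
  have h1 : ∀ i, (fun y => fderiv ℝ (fun z => ymDensityOfBasis b A z) y (b i)) =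
      fun y => ∑ j, ∑ k, ⟪curvature A y (b j) (b k),
        covDeriv A (fun z => curvature A z (b j) (b k)) y (b i)⟫ := fun i =>
    funext fun y => fderiv_ymDensityOfBasis_eq b hA2 y (b i) (hval y (b i))
  simp_rw [h1]
  rw [← Finset.sum_add_distrib]
  refine Finset.sum_congr rfl fun i _ => ?_
  rw [fderiv_fun_sum fun j _ => ?_, FunLike.coe_sum, Finset.sum_apply, ← Finset.sum_add_distrib]
  · refine Finset.sum_congr rfl fun j _ => ?_
    rw [fderiv_fun_sum fun k _ => ((hFd j k) _).inner ℝ ((hDd i j k) _), FunLike.coe_sum,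
      Finset.sum_apply, ← Finset.sum_add_distrib]
    refine Finset.sum_congr rfl fun k _ => ?_
    rw [fderiv_frobenius_inner_eq_covDeriv ((hFd j k) x) ((hDd i j k) x) (b i) (hval x (b i)),
      real_inner_self_eq_norm_sq]
  · exact DifferentiableAt.fun_sum fun k _ => ((hFd j k) _).inner ℝ ((hDd i j k) _)

/-- **The Bochner identity along the Yang–Mills heat flow.** Let `A` be jointly smooth on
`𝒯 × E` (`𝒯` open), `𝔲(m)`-valued at the time `t ∈ 𝒯` and solving `∂ₜA = div_A F = −D^*F` at `t`.
Then at every `x`, with `e = ∑_{j<k}‖F_{jk}‖²`,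
`∂ₜ e − ∑ᵢ ∂ᵢ∂ᵢ e = −∑_{ijk} ‖DᵢF_{jk}‖² + 2 ∑_{ijk} ⟨F_{jk}, [F_{j bᵢ}, F_{bᵢ k}]⟩`
("`(∂ₜ + Δ)|F|² = −2|∇F|² + F#F#F`"; note `∑_{ijk}‖DᵢF_{jk}‖² = 2|∇F|²` with `|·|² = ∑_{j<k}`).
[cite: Waldron2019, proof of Prop. 3.4; Waldron2016, §2 (2.1)] -/
theorem deriv_ymDensityOfBasis_sub_laplacian_eq (b : OrthonormalBasis ι ℝ E)
    {A : ℝ → Connection E (Matrix m m ℂ)} {𝒯 : Set ℝ} (h𝒯 : IsOpen 𝒯)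
    (hA : ContDiffOn ℝ ∞ (fun p : ℝ × E => A p.1 p.2) (𝒯 ×ˢ (univ : Set E)))
    (hpde : ∀ ⦃s : ℝ⦄, s ∈ 𝒯 → ∀ y w, deriv (fun s' => A s' y w) s = divCurvature (A s) y w)
    {t : ℝ} (ht : t ∈ 𝒯) (hval : (A t).IsValuedIn (skewAdjoint.submodule ℝ (Matrix m m ℂ)))
    (x : E) :
    deriv (fun s => ymDensityOfBasis b (A s) x) t -
        ∑ i, fderiv ℝ (fun y => fderiv ℝ (fun z => ymDensityOfBasis b (A t) z) y (b i)) x (b i) =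
      -(∑ i, ∑ j, ∑ k, ‖covDeriv (A t) (fun z => curvature (A t) z (b j) (b k)) x (b i)‖ ^ 2) +
        2 * ∑ i, ∑ j, ∑ k, ⟪curvature (A t) x (b j) (b k),
          ⁅curvature (A t) x (b j) (b i), curvature (A t) x (b i) (b k)⁆⟫ := by
  have hsm : ContDiff ℝ ∞ (A t) := contDiff_slice_of_contDiffOn_prod hA ht
  have hA3 : ContDiff ℝ 3 (A t) := hsm.of_le ENat.LEInfty.out
  -- the time derivative of `e`
  set L : ι → ι → Matrix m m ℂ := fun j k =>
    ∑ i, covDeriv (A t) (fun y => covDeriv (A t) (fun z => curvature (A t) z (b j) (b k)) y (b i))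
      x (b i) with hL
  set Q : ι → ι → Matrix m m ℂ := fun j k =>
    ∑ i, ⁅curvature (A t) x (b j) (b i), curvature (A t) x (b i) (b k)⁆ with hQ
  have hFjk : ∀ j k, HasDerivAt (fun s => ‖curvature (A s) x (b j) (b k)‖ ^ 2)
      (2 * ⟪curvature (A t) x (b j) (b k), L j k + (2 : ℝ) • Q j k⟫) t := fun j k =>
    (hasDerivAt_curvature_of_flow b h𝒯 hA hpde ht x (b j) (b k)).norm_sq
  have he : HasDerivAt (fun s => ymDensityOfBasis b (A s) x)
      ((∑ j, ∑ k, 2 * ⟪curvature (A t) x (b j) (b k), L j k + (2 : ℝ) • Q j k⟫) / 2) t := by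
    have heq : (fun s => ymDensityOfBasis b (A s) x) =
        fun s => (∑ j, ∑ k, ‖curvature (A s) x (b j) (b k)‖ ^ 2) / 2 :=
      funext fun s => ymDensityOfBasis_eq_half_sum b (A s) x
    rw [heq]
    exact (HasDerivAt.fun_sum fun j _ => HasDerivAt.fun_sum fun k _ => hFjk j k).div_const 2
  rw [he.deriv, sum_fderiv_fderiv_ymDensityOfBasis_eq b hA3 hval x]
  -- bookkeeping
  have e1 : (∑ j, ∑ k, 2 * ⟪curvature (A t) x (b j) (b k), L j k + (2 : ℝ) • Q j k⟫) / 2 =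
      (∑ j, ∑ k, ⟪curvature (A t) x (b j) (b k), L j k⟫) +
        2 * ∑ j, ∑ k, ⟪curvature (A t) x (b j) (b k), Q j k⟫ := by
    simp only [inner_add_right, inner_smul_right, mul_add, Finset.sum_add_distrib, ← Finset.mul_sum]
    ring
  have e2 : ∑ j, ∑ k, ⟪curvature (A t) x (b j) (b k), L j k⟫ =
      ∑ i, ∑ j, ∑ k, ⟪curvature (A t) x (b j) (b k),
        covDeriv (A t) (fun y => covDeriv (A t) (fun z => curvature (A t) z (b j) (b k)) y (b i))
          x (b i)⟫ := by
    simp only [hL, inner_sum]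
    exact (Finset.sum_congr rfl fun j _ => Finset.sum_comm (f := fun k i =>
      ⟪curvature (A t) x (b j) (b k), covDeriv (A t) (fun y => covDeriv (A t)
        (fun z => curvature (A t) z (b j) (b k)) y (b i)) x (b i)⟫)).trans
      (Finset.sum_comm (f := fun j i => ∑ k, ⟪curvature (A t) x (b j) (b k),
        covDeriv (A t) (fun y => covDeriv (A t) (fun z => curvature (A t) z (b j) (b k)) y (b i))
          x (b i)⟫))
  have e3 : ∑ j, ∑ k, ⟪curvature (A t) x (b j) (b k), Q j k⟫ =
      ∑ i, ∑ j, ∑ k, ⟪curvature (A t) x (b j) (b k),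
        ⁅curvature (A t) x (b j) (b i), curvature (A t) x (b i) (b k)⁆⟫ := by
    simp only [hQ, inner_sum]
    exact (Finset.sum_congr rfl fun j _ => Finset.sum_comm (f := fun k i =>
      ⟪curvature (A t) x (b j) (b k), ⁅curvature (A t) x (b j) (b i), curvature (A t) x (b i) (b k)⁆⟫)).trans
      (Finset.sum_comm (f := fun j i => ∑ k, ⟪curvature (A t) x (b j) (b k),
        ⁅curvature (A t) x (b j) (b i), curvature (A t) x (b i) (b k)⁆⟫))
  rw [e1, e2, e3]
  ring

/-- `|⟨X, [Y, Z]⟩| ≤ 2 ‖X‖ ‖Y‖ ‖Z‖` for the Hilbert–Schmidt inner product and norm (Cauchy–Schwarz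
and submultiplicativity). [folklore] -/
theorem abs_frobenius_inner_lie_le (X Y Z : Matrix m m ℂ) : |⟪X, ⁅Y, Z⁆⟫| ≤ 2 * ‖X‖ * ‖Y‖ * ‖Z‖ := by
  have h1 : |⟪X, ⁅Y, Z⁆⟫| ≤ ‖X‖ * ‖⁅Y, Z⁆‖ := abs_real_inner_le_norm X ⁅Y, Z⁆
  have h2 : ‖⁅Y, Z⁆‖ ≤ 2 * ‖Y‖ * ‖Z‖ := by
    rw [Ring.lie_def]
    calc ‖Y * Z - Z * Y‖ ≤ ‖Y * Z‖ + ‖Z * Y‖ := norm_sub_le _ _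
      _ ≤ ‖Y‖ * ‖Z‖ + ‖Z‖ * ‖Y‖ := add_le_add (norm_mul_le _ _) (norm_mul_le _ _)
      _ = 2 * ‖Y‖ * ‖Z‖ := by ring
  calc |⟪X, ⁅Y, Z⁆⟫| ≤ ‖X‖ * ‖⁅Y, Z⁆‖ := h1
    _ ≤ ‖X‖ * (2 * ‖Y‖ * ‖Z‖) := mul_le_mul_of_nonneg_left h2 (norm_nonneg _)
    _ = 2 * ‖X‖ * ‖Y‖ * ‖Z‖ := by ring

omit [FiniteDimensional ℝ E] in
/-- Each curvature component is bounded by `√(2e)`: `‖F_{jk}‖ ≤ √(∑_{jk}‖F_{jk}‖²) = √(2e)`.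
[folklore] -/
theorem norm_curvature_apply_le_sqrt (b : OrthonormalBasis ι ℝ E) (A : Connection E (Matrix m m ℂ))
    (x : E) (j k : ι) :
    ‖curvature A x (b j) (b k)‖ ≤ Real.sqrt (2 * ymDensityOfBasis b A x) := by
  have hsum : ‖curvature A x (b j) (b k)‖ ^ 2 ≤ ∑ j', ∑ k', ‖curvature A x (b j') (b k')‖ ^ 2 := by
    calc ‖curvature A x (b j) (b k)‖ ^ 2 ≤ ∑ k', ‖curvature A x (b j) (b k')‖ ^ 2 :=
          Finset.single_le_sum (f := fun k' => ‖curvature A x (b j) (b k')‖ ^ 2)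
            (fun k' _ => by positivity) (Finset.mem_univ k)
      _ ≤ ∑ j', ∑ k', ‖curvature A x (b j') (b k')‖ ^ 2 :=
          Finset.single_le_sum (f := fun j' => ∑ k', ‖curvature A x (b j') (b k')‖ ^ 2)
            (fun j' _ => Finset.sum_nonneg fun k' _ => by positivity) (Finset.mem_univ j)
  have he : 2 * ymDensityOfBasis b A x = ∑ j', ∑ k', ‖curvature A x (b j') (b k')‖ ^ 2 := by
    rw [ymDensityOfBasis_eq_half_sum b A x]
    ring
  rw [he, ← Real.sqrt_sq (norm_nonneg (curvature A x (b j) (b k)))]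
  exact Real.sqrt_le_sqrt hsum

/-- **The differential inequality for the energy density along the Yang–Mills heat flow**
(Waldron 2019, proof of Prop. 3.4: "recall the differential inequality `(∂ₜ − Δ)v ≤ Av² + Bv`",
`v = |F|`, here in the flat case `B = 0` and for `v² = e`; [instantons] (2.1)). With
`e = ∑_{j<k}‖F_{jk}‖²` at `(t, x)`:
`∂ₜ e − ∑ᵢ ∂ᵢ∂ᵢ e ≤ −∑_{ijk}‖DᵢF_{jk}‖² + 8√2 (card ι)³ e^{3/2}`.
[cite: Waldron2019, proof of Prop. 3.4; Waldron2016, §2 (2.1)] -/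
theorem deriv_ymDensityOfBasis_sub_laplacian_le (b : OrthonormalBasis ι ℝ E)
    {A : ℝ → Connection E (Matrix m m ℂ)} {𝒯 : Set ℝ} (h𝒯 : IsOpen 𝒯)
    (hA : ContDiffOn ℝ ∞ (fun p : ℝ × E => A p.1 p.2) (𝒯 ×ˢ (univ : Set E)))
    (hpde : ∀ ⦃s : ℝ⦄, s ∈ 𝒯 → ∀ y w, deriv (fun s' => A s' y w) s = divCurvature (A s) y w)
    {t : ℝ} (ht : t ∈ 𝒯) (hval : (A t).IsValuedIn (skewAdjoint.submodule ℝ (Matrix m m ℂ)))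
    (x : E) :
    deriv (fun s => ymDensityOfBasis b (A s) x) t -
        ∑ i, fderiv ℝ (fun y => fderiv ℝ (fun z => ymDensityOfBasis b (A t) z) y (b i)) x (b i) ≤
      -(∑ i, ∑ j, ∑ k, ‖covDeriv (A t) (fun z => curvature (A t) z (b j) (b k)) x (b i)‖ ^ 2) +
        8 * Real.sqrt 2 * (Fintype.card ι : ℝ) ^ 3 *
          (ymDensityOfBasis b (A t) x * Real.sqrt (ymDensityOfBasis b (A t) x)) := by
  rw [deriv_ymDensityOfBasis_sub_laplacian_eq b h𝒯 hA hpde ht hval x]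
  set e : ℝ := ymDensityOfBasis b (A t) x with he
  have he0 : 0 ≤ e := ymDensityOfBasis_nonneg b _ x
  have hF : ∀ j k, ‖curvature (A t) x (b j) (b k)‖ ≤ Real.sqrt (2 * e) := fun j k =>
    norm_curvature_apply_le_sqrt b (A t) x j k
  have hcube : Real.sqrt (2 * e) ^ 3 = 2 * Real.sqrt 2 * (e * Real.sqrt e) := by
    rw [pow_succ, Real.sq_sqrt (by positivity), Real.sqrt_mul (by norm_num : (0 : ℝ) ≤ 2)]
    ring
  have hterm : ∀ i j k, ⟪curvature (A t) x (b j) (b k),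
      ⁅curvature (A t) x (b j) (b i), curvature (A t) x (b i) (b k)⁆⟫ ≤
      4 * Real.sqrt 2 * (e * Real.sqrt e) := by
    intro i j k
    refine (le_abs_self _).trans ((abs_frobenius_inner_lie_le _ _ _).trans ?_)
    calc 2 * ‖curvature (A t) x (b j) (b k)‖ * ‖curvature (A t) x (b j) (b i)‖ *
          ‖curvature (A t) x (b i) (b k)‖
        ≤ 2 * Real.sqrt (2 * e) * Real.sqrt (2 * e) * Real.sqrt (2 * e) := by
          have h1 := hF j k
          have h2 := hF j i
          have h3 := hF i k
          have h0 : 0 ≤ Real.sqrt (2 * e) := Real.sqrt_nonneg _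
          apply mul_le_mul (mul_le_mul (mul_le_mul_of_nonneg_left h1 (by norm_num)) h2
            (norm_nonneg _) (by positivity)) h3 (norm_nonneg _) (by positivity)
      _ = 2 * Real.sqrt (2 * e) ^ 3 := by ring
      _ = 4 * Real.sqrt 2 * (e * Real.sqrt e) := by rw [hcube]; ring
  have hsum : ∑ i, ∑ j, ∑ k, ⟪curvature (A t) x (b j) (b k),
      ⁅curvature (A t) x (b j) (b i), curvature (A t) x (b i) (b k)⁆⟫ ≤
      (Fintype.card ι : ℝ) ^ 3 * (4 * Real.sqrt 2 * (e * Real.sqrt e)) := by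
    calc ∑ i, ∑ j, ∑ k, ⟪curvature (A t) x (b j) (b k),
          ⁅curvature (A t) x (b j) (b i), curvature (A t) x (b i) (b k)⁆⟫
        ≤ ∑ _i : ι, ∑ _j : ι, ∑ _k : ι, 4 * Real.sqrt 2 * (e * Real.sqrt e) :=
          Finset.sum_le_sum fun i _ => Finset.sum_le_sum fun j _ => Finset.sum_le_sum fun k _ =>
            hterm i j k
      _ = (Fintype.card ι : ℝ) ^ 3 * (4 * Real.sqrt 2 * (e * Real.sqrt e)) := by
          simp only [Finset.sum_const, Finset.card_univ, nsmul_eq_mul]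
          ring
  nlinarith [hsum]

end Bochner

end Literature.MathematicalPhysics.QuantumLattice
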